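import Summits.AnomalousDissipation.AnomalousDissipation.Theorems.SolenoidalFractalHomogenisationLagrangianStepFrameToEulerianMembers
import Summits.AnomalousDissipation.AnomalousDissipation.Theorems.SolenoidalFractalHomogenisationLagrangianStepFrameConjugatePropagatorClamped
import Summits.AnomalousDissipation.AnomalousDissipation.Theorems.SolenoidalFractalHomogenisationLagrangianStepFrameConjugacyAssemblyCurve
import HarnessLib

/-!
# K1L_D (stmt-AnomalousDissipation-27980), `stub_Z7_alphaBeta` α-provider ASSEMBLED MODULO ITS TWO REMAINING INPUTS: `FrameConjugacyAt` on a
# closed piece `[jR, t]` from (i) a modulation datum for the exact-flow frame and (ii) the Eulerian representation property of the two window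
# propagators (helper; `--supports … --as helper`; lead-k1l-onelevel-p1 g5)

Everything else of memo L13/L16's α-provider is now in the tree: the clamped conjugate propagators (`isDistortedPropagator_conjProp_clamped`,
p701146) fed with the hypothesis-free solenoidality equivalence (`isWeaklyDivFree_distort_frameRead_iff'`, p700218) and the two transfer
hypotheses `hT1_true` / `hT1_coarse` (p704635: (T1) (C0)–(C6) along the clamped curve), and the curve-generic (T4) `frameConjugacyAt_of_clamped`
(p701171).  **`frameConjugacyAt_of_inputs`**: for an `LPermissible`, `LevelRegular` carrier replaying `W.stretch M`, a piece `[jR, t]` of the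
closed refresh window inside `[0,1]`, the Eulerian propagators `Um1` (along `b_{≤m+1}`, tensor `kbar (m+1) • S`) and `Um` (along `b_{≤m}`,
tensor `kbar m • renormStep …`), one gets `FrameConjugacyAt W M hM gain Φ Cα ϱ E m S Um1 Um (jR) t` FROM
(hmod) `IsModulation θ (a(t−jR)) (ϱ N m) (τ ↦ frameG E m (jR + τ/a) jR)` with `0 ≤ θ ≤ Cα θ(m+1)` — p3 g8's `isModulation_frameG` + K8-5 `hcurv`
(k3l g8) + the closed endpoint (`…ClosedWindow`) — and (hErepr) the representation of flat weak solutions on sub-windows by `Um1`, `Um`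
(`FrameConj.eulerian_subwindow_repr`, p698742, to be instantiated: `B ∈ L^∞`, `NearIso`).  NOT a proof of the stub, of the crux, or of AD;
rung F-D1.A0.
-/

set_option linter.dupNamespace false  -- the summit-side namespace `Summit.AnomalousDissipation.AnomalousDissipation.…` repeats a component by design (D-0017)

noncomputable section

namespace Summit.AnomalousDissipation.AnomalousDissipation.Theorems.SolenoidalFractalHomogenisation.LagrangianStep.FrameConj

open Set Function Filter MeasureTheory Topology
open scoped NNReal ENNReal
open Literature.Analysis Literature.Analysis.FunctionSpaces Literature.Analysis.FunctionSpaces.Torus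
open Literature.Analysis.FluidPDE Literature.Analysis.FluidPDE.LatticeShear
open Literature.Analysis.FluidPDE.LatticeShear (LagrangianLatticeCarrier LatticeWord)
open Summit.AnomalousDissipation.AnomalousDissipation.Theorems.SolenoidalFractalHomogenisation.LagrangianStep.CellClauseMod
open Summit.AnomalousDissipation.AnomalousDissipation.Theorems.SolenoidalFractalHomogenisation.LagrangianStep.Z7Glue

variable {k : ℕ}

/-- **`FrameConjugacyAt` on a closed piece from the modulation datum and the Eulerian representation property.**  See the module docstring. -/
theorem frameConjugacyAt_of_inputs (E : LagrangianLatticeCarrier k) (hL : E.LPermissible) (hR : E.LevelRegular) {W : LatticeWord k}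
    {M : ℝ} {hM : 0 < M} (hdes : E.design = W.stretch M hM) (Φ : ℝ → Torus.Visc4 (Fin 3) → Torus.Visc4 (Fin 3))
    {Cα ϱ θ : ℝ} (m j : ℕ) (S : Torus.Visc4 (Fin 3)) {t : ℝ}
    (hj0 : 0 ≤ (j : ℝ) * E.refresh (m + 1)) (hjt : (j : ℝ) * E.refresh (m + 1) < t)
    (htR : t ≤ (j : ℝ) * E.refresh (m + 1) + E.refresh (m + 1)) (ht1 : t ≤ 1)
    (hν : 0 < E.cellVisc (m + 1)) (hθ0 : 0 ≤ θ) (hθ : θ ≤ Cα * E.θ (m + 1)) (hϱ : 0 ≤ ϱ)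
    (hmod : IsModulation θ (E.a (m + 1) * (t - (j : ℝ) * E.refresh (m + 1))) (ϱ * E.N m)
      (fun τ y => frameG E m ((j : ℝ) * E.refresh (m + 1) + τ / E.a (m + 1)) ((j : ℝ) * E.refresh (m + 1)) y))
    {Um Um1 : ℝ → ℝ → (V2 →L[ℝ] V2)}
    (hU1 : Torus.IsPropagator 1 (E.partialSum (m + 1)) (E.kbar (m + 1) • S) Um1)
    (hU : Torus.IsPropagator 1 (E.partialSum m) (E.kbar m • renormStep (Φ (E.cellVisc (m + 1))) (E.gain / E.cellVisc (m + 1) ^ 2) S) Um)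
    (hErepr1 : ∀ t₁ : ℝ, (j : ℝ) * E.refresh (m + 1) ≤ t₁ → t₁ < t → ∀ (φE : VF) (hφE : MemLp φE 2 volume),
      Torus.IsWeaklyDivFree φE → ∀ u : ℝ → VF,
      Torus.IsWeakTensorPassiveVectorOn 0 (t - t₁) (E.kbar (m + 1) • S) (fun τ' => E.partialSum (m + 1) (t₁ + τ')) φE u →
      ∀ᵐ τ' ∂(volume.restrict (Ioo 0 (t - t₁))), ∃ hτ : MemLp (u τ') 2 volume, hτ.toLp (u τ') = Um1 t₁ (t₁ + τ') (hφE.toLp φE))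
    (hErepr : ∀ t₁ : ℝ, (j : ℝ) * E.refresh (m + 1) ≤ t₁ → t₁ < t → ∀ (φE : VF) (hφE : MemLp φE 2 volume),
      Torus.IsWeaklyDivFree φE → ∀ u : ℝ → VF,
      Torus.IsWeakTensorPassiveVectorOn 0 (t - t₁) (E.kbar m • renormStep (Φ (E.cellVisc (m + 1))) (E.gain / E.cellVisc (m + 1) ^ 2) S)
        (fun τ' => E.partialSum m (t₁ + τ')) φE u →
      ∀ᵐ τ' ∂(volume.restrict (Ioo 0 (t - t₁))), ∃ hτ : MemLp (u τ') 2 volume, hτ.toLp (u τ') = Um t₁ (t₁ + τ') (hφE.toLp φE)) :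
    FrameConjugacyAt W M hM E.gain Φ Cα ϱ E m S Um1 Um ((j : ℝ) * E.refresh (m + 1)) t := by
  have hL1 : ∀ (σ : ℝ) (u : V2),
      Torus.IsWeaklyDivFree (Torus.distort (frameG E m ((j : ℝ) * E.refresh (m + 1) + σ / E.a (m + 1)) ((j : ℝ) * E.refresh (m + 1)))
        (⇑(frameRead E hR m ((j : ℝ) * E.refresh (m + 1)) σ u) : VF)) ↔ Torus.IsWeaklyDivFree (⇑u : VF) :=
    fun σ u => isWeaklyDivFree_distort_frameRead_iff' E hR m _ σ u
  have hUt := isDistortedPropagator_conjProp_clamped E hR m hj0 hjt ht1 hU1 hL1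
    (𝔸c := (1 / (E.N (m + 1) : ℝ) ^ 2) • (E.cellVisc (m + 1) • S))
    (bc := cellField W M hM (E.cellVisc (m + 1)) hν (E.N (m + 1)))
    (hT1_true E hL hR hdes m j hjt.le htR S hν) hErepr1
  have hTt := isDistortedPropagator_conjProp_clamped E hR m hj0 hjt ht1 hU hL1
    (𝔸c := (1 / (E.N (m + 1) : ℝ) ^ 2) • (E.cellVisc (m + 1) • S +
      (E.gain / E.cellVisc (m + 1)) • Φ (E.cellVisc (m + 1)) ((1 / E.cellVisc (m + 1)) • (E.cellVisc (m + 1) • S))))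
    (bc := fun (_ : ℝ) (_ : UnitAddTorus (Fin 3)) => (0 : EuclideanSpace ℝ (Fin 3)))
    (hT1_coarse E hL hR m j hjt.le htR Φ S) hErepr
  exact frameConjugacyAt_of_clamped E hR m S hjt.le hν hθ0 hθ hϱ hmod hUt hTt

end Summit.AnomalousDissipation.AnomalousDissipation.Theorems.SolenoidalFractalHomogenisation.LagrangianStep.FrameConj

end
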